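import Summits.BirchSwinnertonDyer.Rank1Residual.Iwasawa.LocalTowerKernelCardLeTorsion
import Summits.BirchSwinnertonDyer.Rank1Residual.X11b.BDPRouteLocalKernelExact
import Literature.NumberTheory.EllipticCurves.NeronOggShafarevichLocal
import Literature.NumberTheory.EllipticCurves.GeomPointsGaloisModule
import HarnessLib

/-!
# Tamagawa-tolerant control, ♯: Greenberg's Lemma 3.3 at a place `v ∤ p` with the SHARP Tamagawa
# bound `#𝒦_{v,0}[p^∞] ≤ c_v^{(p)}`, for ANY `ℤ_p`-extension and ANY reduction type
# (team n1011, row T-CTL-TAM, seat p06 GEN 10, FILE 6 = T-CTL-TAM♯)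

HONEST FRAMING (cell `b2b-bsdres-*`, team n1011, verbatim): prove what is provable now; shrink each
hard class to its core with data; no claim beyond stated classes. Research route; TOOL theorems
only — no definition, no named fact, nothing booked, no residual-map mark moved, no class closed.

## What

FILE 2 (`Iwasawa/LocalTowerKernelCardLeTorsion`) bounded `#𝒦_{v,0}[p^∞]` — the `p`-power torsion of
the level-`0` local tower kernel `𝒦_{v,0} = ker (H¹(K_v, E) → H¹(K_{∞,η}, E))` — by `#E(K_v)[p^∞]`.
Greenberg's value (LNM 1716, §3 Lemma 3.3, p. 87; proof of Thm. 4.1, p. 74: "`ker r_v` … has order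
`c_v^{(p)}`") is the `p`-part of the TAMAGAWA NUMBER, which is smaller (`= 1` at a non-Tamagawa split
multiplicative `v` with `N v ≡ 1 (mod p)`, where `#E(K_v)[p] > 1`). Sub-cells multr1-p1 and multr1-p2
proved the sharp count in the `GreenbergSelmer` currency of X11b (`B_v = E[p^∞]^{ker κ ⊓ D_v}` for
the decomposition group `D_v ≤ Γ_K`, `E[p^∞] ⊆ E(K̄)`):
`AcSelmer.index_range_decompSubOne_eq_pow : [B_v : (γ_v − 1)B_v] = p ^ ord_p c_v` (multr1-p2
GEN 20, `X11b/BDPRouteLocalKernelExact`). THIS FILE transports that count to the Literature/n1011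
currency WITHOUT Krasner's lemma: the bridge sits at the level of the coinvariant quotient, not of
cohomology classes. With `M_∞ = E(K̄_v)^{H_{v,∞}}`, `B = M_∞[p^∞]` and a generator `g` of
`Γ_{K_v}` modulo `H_{v,∞}` (tree): `B ≅ B_v` as groups — every `p`-power torsion point of `E(K̄_v)` is
algebraic (`exists_pointsMapOfEmb_eq_of_nsmul_eq_zero`) and `D_v = res(Γ_{K_v})` (`mem_decomp_iff`,
`resGal_eq_absGaloisRestrict`) — compatibly with `g − 1` on `B` and `γ_v − 1 = decompSubOne (res g)` on
`B_v` (`pointsMap_smul`); and `res g` generates `D_v` modulo `D_v ⊓ ker κ` (pull back open subgroups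
along `Γ_{K_v} ↠ D_v`). Hence

  `#𝒦_{v,0}[p^∞] ≤ #(M_∞/(g−1)M_∞)[p^∞] ≤ #B/(g−1)B = [B_v : (γ_v − 1)B_v] = p ^ ord_p c_v`

(steps (a) `M_∞/B` `p`-divisible and (c) verbatim from the tree's Lemma 3.3 at `n = 0`, as in FILE 2;
if `v` splits completely in `K_∞/K` the whole kernel vanishes, `localTowerKer_eq_bot_of_forall_mem`).

* **`natCard_localTowerKerPrimary_zero_le_pow_padicValNat_localTamagawaNumber (hpv : (p : 𝓞 K) ∉ v.asIdeal) :
  Nat.card (W.localTowerKerPrimary κ (v.adicCompletion K) 0) ≤ p ^ ord_p c_v`** — any number field,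
  ANY `ℤ_p`-extension, ANY reduction type at `v ∤ p`;
* `finite_and_natCard_localTowerKerPrimary_zero_le_pow_padicValNat_localTamagawaNumber` — with the
  finiteness: the packet FILE 4's CORE♯ reads as `hC` with `e_v = ord_p c_v` and NO socket at the
  bad places away from `p`.

NOT claimed: equality (X11b has it, `LocalKernelTamagawaExact`; the lower half needs only `≤`); the
places above `p`; anything about the upper half. Axioms standard.

References: [GreenbergLNM1716] §3 Lemma 3.3 (pp. 86–88), §4 proof of Thm. 4.1 (p. 74);
[SilvermanAEC2009] Cor. III.6.4 (b) (torsion is algebraic), VIII.§1; cells/n1011/skel/T-CTL-TAM.md §5.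
-/

noncomputable section

open scoped Classical NNReal

open NumberField IsDedekindDomain Field ValuativeRel

universe u

namespace Summit.BirchSwinnertonDyer.Rank1Residual.Iwasawa

open Literature.NumberTheory.EllipticCurves Literature.NumberTheory.GaloisRepresentations
  Literature.NumberTheory.GaloisRepresentations.IsNonarchimedeanLocalField
  Literature.NumberTheory.EllipticCurves.FormalGroupChart Literature.NumberTheory.EllipticCurves.ResKernel
  Literature.NumberTheory.EllipticCurves.GreenbergSelmer
  Field IsDedekindDomain.HeightOneSpectrum WeierstrassCurve
  Summit.BirchSwinnertonDyer.Rank1Residual.X11b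

variable {K : Type u} [Field K] [NumberField K] (W : WeierstrassCurve K) {v : HeightOneSpectrum (𝓞 K)}
  {p : ℕ} [Fact p.Prime] (κ : ZpExtension K p)

/-- **Pull-back of topological generation along `Γ_{K_v} ↠ D_v`.** If `g ∈ Γ_{K_v}` generates
`Γ_{K_v} = H_{v,0}` topologically together with `H_{v,∞} = res⁻¹(ker κ)` (the tree's
`ZpExtension.exists_mem_localSubgroup_generate` at `n = 0`), then `res g` generates X11b's
`⊤ ⊓ D_v` topologically together with `(ker κ).subgroupOf (⊤ ⊓ D_v)` — the hypothesis `hgen` of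
`AcSelmer.index_range_decompSubOne_eq_pow`: an open subgroup `U` of `⊤ ⊓ D_v` containing both pulls
back along the continuous homomorphism `σ ↦ res σ` (onto, as `D_v = res Γ_{K_v}`, `mem_decomp_iff`) to
an open subgroup of `Γ_{K_v}` containing `H_{v,∞}` and `g`, hence everything. [folklore] -/
theorem decomp_generate_of_localSubgroup_generate {g : Field.absoluteGaloisGroup (v.adicCompletion K)}
    (hgen : ∀ U : Subgroup (Field.absoluteGaloisGroup (v.adicCompletion K)),
      IsOpen (U : Set (Field.absoluteGaloisGroup (v.adicCompletion K))) →
        localSubgroup κ.kerSubgroup (v.adicCompletion K) ≤ U → g ∈ U →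
          localSubgroup (κ.layerSubgroup 0) (v.adicCompletion K) ≤ U)
    (hgD : resGal (K := K) (v.adicCompletion K) g ∈ decomp v) :
    ∀ U : Subgroup ↥((⊤ : Subgroup (Field.absoluteGaloisGroup K)) ⊓ decomp v),
      IsOpen (U : Set ↥((⊤ : Subgroup (Field.absoluteGaloisGroup K)) ⊓ decomp v)) →
        κ.kerSubgroup.subgroupOf ((⊤ : Subgroup (Field.absoluteGaloisGroup K)) ⊓ decomp v) ≤ U →
          (⟨resGal (K := K) (v.adicCompletion K) g, Subgroup.mem_inf.mpr ⟨Subgroup.mem_top _, hgD⟩⟩ :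
            ↥((⊤ : Subgroup (Field.absoluteGaloisGroup K)) ⊓ decomp v)) ∈ U → U = ⊤ := by
  intro U hUopen hNU hγU
  have hmem0 : ∀ σ : Field.absoluteGaloisGroup (v.adicCompletion K),
      σ ∈ localSubgroup (κ.layerSubgroup 0) (v.adicCompletion K) := fun σ ↦ by
    rw [mem_localSubgroup_iff, ZpExtension.layerSubgroup_zero]
    exact Subgroup.mem_top _
  have hresD : ∀ σ : Field.absoluteGaloisGroup (v.adicCompletion K),
      resGal (K := K) (v.adicCompletion K) σ ∈ decomp v := fun σ ↦
    (mem_decomp_iff v _).mpr ⟨σ, by rw [← resGal_eq_absGaloisRestrict]⟩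
  -- pull back along `θ : Γ_{K_v} → ⊤ ⊓ D_v`
  let θ : Field.absoluteGaloisGroup (v.adicCompletion K) →*
      ↥((⊤ : Subgroup (Field.absoluteGaloisGroup K)) ⊓ decomp v) :=
    { toFun := fun σ ↦ ⟨resGal (K := K) (v.adicCompletion K) σ,
        Subgroup.mem_inf.mpr ⟨Subgroup.mem_top _, hresD σ⟩⟩
      map_one' := Subtype.ext (map_one _)
      map_mul' := fun a b ↦ Subtype.ext (map_mul _ a b) }
  have hθcont : Continuous θ :=
    (resGal (K := K) (v.adicCompletion K)).continuous_toFun.subtype_mk _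
  have hle := hgen (U.comap θ) (hUopen.preimage hθcont)
    (fun τ hτ ↦ hNU (Subgroup.mem_subgroupOf.mpr ((mem_localSubgroup_iff _ _ τ).mp hτ)))
    (show θ g ∈ U from hγU)
  rw [eq_top_iff]
  rintro ⟨x, hx⟩ -
  obtain ⟨σ, hσ⟩ := (mem_decomp_iff v x).mp (Subgroup.mem_inf.mp hx).2
  rw [← resGal_eq_absGaloisRestrict] at hσ
  have hσU : θ σ ∈ U := hle (hmem0 σ)
  have hθσ : θ σ = ⟨x, hx⟩ := Subtype.ext hσ
  rwa [hθσ] at hσU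

set_option maxHeartbeats 1600000 in
/-- **Greenberg's Lemma 3.3 at `n = 0` with the SHARP Tamagawa bound: `#𝒦_{v,0}[p^∞] ≤ p ^ ord_p c_v`
at every `v ∤ p`, for ANY `ℤ_p`-extension and ANY reduction type** (`E = W` elliptic over a number
field `K`; `c_v` the local Tamagawa number of `W/K_v`). Steps (a) (`M_∞/B` is `p`-divisible) and (c)
(`𝒦_{v,0}[p^∞] ↪ (M_∞/(g−1)M_∞)[p^∞] = im B/(g−1)B`) are the tree's; step (b♯) identifies `B/(g−1)B`
with X11b's `B_v/(γ_v − 1)B_v` (`γ_v = res g`; `p`-power torsion is algebraic, `D_v = res Γ_{K_v}`) and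
reads `[B_v : (γ_v − 1)B_v] = p ^ ord_p c_v` from `AcSelmer.index_range_decompSubOne_eq_pow`
(multr1-p2). If `v` splits completely in `K_∞/K` the kernel is `0`. Greenberg, LNM 1716, §3 Lemma 3.3
(p. 87) and §4 p. 74 ("`ker r_v` has order `c_v^{(p)}`").
[cite: GreenbergLNM1716, §3 Lemma 3.3 (proof, pp. 86–88) and §4 proof of Thm. 4.1 (p. 74)]
[cite: SilvermanAEC2009, Cor. III.6.4 (b)] -/
theorem natCard_localTowerKerPrimary_zero_le_pow_padicValNat_localTamagawaNumber [W.IsElliptic]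
    (hpv : (p : 𝓞 K) ∉ v.asIdeal) :
    Nat.card (W.localTowerKerPrimary κ (v.adicCompletion K) 0) ≤
      p ^ padicValNat p ((W.baseChange (v.adicCompletion K)).localTamagawaNumber
        (v.adicCompletionIntegers K)) := by
  -- notation
  let G : Type u := Field.absoluteGaloisGroup (v.adicCompletion K)
  let Pt : Type u := localPoints W (v.adicCompletion K)
  let H0 : Subgroup G := localSubgroup (κ.layerSubgroup 0) (v.adicCompletion K)
  let Hi : Subgroup G := localSubgroup κ.kerSubgroup (v.adicCompletion K)
  have hmem0 : ∀ σ : G, σ ∈ H0 := fun σ ↦ by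
    change σ ∈ localSubgroup (κ.layerSubgroup 0) (v.adicCompletion K)
    rw [mem_localSubgroup_iff, ZpExtension.layerSubgroup_zero]
    exact Subgroup.mem_top _
  -- the decomposition group `D_v = res Γ_{K_v}`
  have hresD : ∀ σ : G, resGal (K := K) (v.adicCompletion K) σ ∈ decomp v := fun σ ↦
    (mem_decomp_iff v _).mpr ⟨σ, by rw [← resGal_eq_absGaloisRestrict]⟩
  -- (0) the split-completely case: `H_{v,∞} = Γ_{K_v}`, the whole kernel vanishes
  by_cases hsplit : ∀ τ : G, resGal (K := K) (v.adicCompletion K) τ ∈ κ.kerSubgroup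
  · have hbot : W.localTowerKerPrimary κ (v.adicCompletion K) 0 = ⊥ := by
      rw [eq_bot_iff]
      calc W.localTowerKerPrimary κ (v.adicCompletion K) 0
          ≤ W.localTowerKer κ (v.adicCompletion K) 0 :=
            W.localTowerKerPrimary_le_localTowerKer κ (v.adicCompletion K) 0
        _ = ⊥ := W.localTowerKer_eq_bot_of_forall_mem κ (v.adicCompletion K) 0 hsplit
        _ ≤ ⊥ := le_rfl
    rw [hbot, AddSubgroup.card_bot]
    exact Nat.one_le_pow _ _ (Fact.out : p.Prime).pos
  have hv : ¬ decomp v ≤ κ.kerSubgroup := fun h ↦ hsplit fun τ ↦ h (hresD τ)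
  -- a topological generator `g` of `H_{v,0}/H_{v,∞}`; reduction to the coinvariants
  obtain ⟨g, hg, hgen⟩ := ZpExtension.exists_mem_localSubgroup_generate κ (v.adicCompletion K) 0
  suffices hfin : Finite (AddCommGroup.primaryComponent
      (FixedPoints.addSubgroup Hi Pt ⧸ (subOne Hi Pt g).range) p) ∧
      Nat.card (AddCommGroup.primaryComponent
        (FixedPoints.addSubgroup Hi Pt ⧸ (subOne Hi Pt g).range) p) ≤
        p ^ padicValNat p ((W.baseChange (v.adicCompletion K)).localTamagawaNumber
          (v.adicCompletionIntegers K)) by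
    haveI := hfin.1
    have hle := (W.finite_localTowerKerPrimary_and_card_le κ (v.adicCompletion K) 0 hg hgen)
    exact hle.2.trans hfin.2
  -- the spectral valuation, the prime `𝔐`, `p ∈ 𝓞_vˣ`, inertia
  obtain ⟨w, hw⟩ := v.exists_spectralValuation
  obtain ⟨𝔐, h𝔐⟩ := v.localPrimesAbove_nonempty
  have hp : IsUnit ((p : ℕ) : (v.adicCompletionIntegers K)) := by
    have h := isUnit_algebraMap_adicCompletionIntegers K v hpv
    rwa [map_natCast] at h
  have hI : ∀ σ ∈ 𝔐.inertia G, σ ∈ Hi := fun σ hσ ↦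
    (mem_localSubgroup_iff _ _ σ).mpr
      (ZpExtension.inertia_le_kerSubgroup_holds K p κ hpv (primeBelow_mem_primesAbove h𝔐)
        (v.resGalOfEmb_mem_inertia_primeBelow (closureEmb (K := K) (v.adicCompletion K)) 𝔐 hσ))
  -- the equivariant transport `E(K̄_v) ≃ V(K̄_v)` to the minimal model
  obtain ⟨C, hC⟩ := W.exists_variableChange_eq_localMinimalIntegralModel v
  haveI := WeierstrassCurve.isIntegral_spectralValuation_baseChange hw (W.localMinimalIntegralModel v)
  have hC' := congrArg (fun X : WeierstrassCurve (v.adicCompletion K) ↦ X.baseChange (AlgebraicClosure (v.adicCompletion K))) hC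
  let Φ : Pt ≃+ (((W.localMinimalIntegralModel v).map (algebraMap (v.adicCompletionIntegers K) (v.adicCompletion K))).baseChange (AlgebraicClosure (v.adicCompletion K))).toAffine.Point :=
    ((WeierstrassCurve.Affine.Point.congrEquiv
        (WeierstrassCurve.baseChange_baseChange_adicCompletion W v).symm).trans
      (WeierstrassCurve.VariableChange.pointEquivBaseChange (W.baseChange (v.adicCompletion K)) C
        (AlgebraicClosure (v.adicCompletion K)))).trans
      (WeierstrassCurve.Affine.Point.congrEquiv hC')
  have hΦ : ∀ (σ : G) (Q : Pt), Φ (σ • Q) = Affine.Point.map ((absoluteGaloisGroup.toAlgEquiv (v.adicCompletion K) σ : AlgebraicClosure (v.adicCompletion K) ≃ₐ[v.adicCompletion K] AlgebraicClosure (v.adicCompletion K)) : AlgebraicClosure (v.adicCompletion K) →ₐ[v.adicCompletion K] AlgebraicClosure (v.adicCompletion K)) (Φ Q) := by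
    intro σ Q
    change WeierstrassCurve.Affine.Point.congrEquiv hC'
        (WeierstrassCurve.VariableChange.pointEquivBaseChange (W.baseChange (v.adicCompletion K)) C (AlgebraicClosure (v.adicCompletion K))
        (WeierstrassCurve.Affine.Point.congrEquiv (WeierstrassCurve.baseChange_baseChange_adicCompletion W v).symm (σ • Q))) =
      WeierstrassCurve.Affine.Point.map _ (WeierstrassCurve.Affine.Point.congrEquiv hC'
        (WeierstrassCurve.VariableChange.pointEquivBaseChange (W.baseChange (v.adicCompletion K)) C (AlgebraicClosure (v.adicCompletion K))
          (WeierstrassCurve.Affine.Point.congrEquiv (WeierstrassCurve.baseChange_baseChange_adicCompletion W v).symm Q)))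
    rw [WeierstrassCurve.congrEquiv_smul, WeierstrassCurve.VariableChange.pointEquivBaseChange_map_algEquiv]
    exact WeierstrassCurve.Affine.Point.congrEquiv_baseChange_map hC _ _
  -- `M_∞ = E(K̄_v)^{H_{v,∞}}`, `f = g - 1`, `B = M_∞[p^∞]`
  set Mi : AddSubgroup Pt := FixedPoints.addSubgroup Hi Pt with hMi
  set f : Mi →+ Mi := subOne Hi Pt g with hf
  set B : AddSubgroup Mi := AddCommGroup.primaryComponent Mi p with hB
  have hMiI : ∀ (m : Mi) (τ : G), τ ∈ 𝔐.inertia G → Affine.Point.map ((absoluteGaloisGroup.toAlgEquiv (v.adicCompletion K) τ : AlgebraicClosure (v.adicCompletion K) ≃ₐ[v.adicCompletion K] AlgebraicClosure (v.adicCompletion K)) : AlgebraicClosure (v.adicCompletion K) →ₐ[v.adicCompletion K] AlgebraicClosure (v.adicCompletion K)) (Φ m) = Φ m := by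
    intro m τ hτ
    rw [← hΦ]
    exact congrArg Φ (m.2 ⟨τ, hI τ hτ⟩)
  -- (a) `M_∞/B` is `p`-divisible (verbatim from the tree's Lemma 3.3 at `n = 0`)
  have hdiv : ∀ y : Mi, ∃ y' : Mi, y - p • y' ∈ B := by
    intro y
    obtain ⟨m, hm, hmK⟩ :=
      W.exists_nsmul_mem_kernel_of_forall_inertia hw h𝔐 (P := Φ y) (fun τ hτ ↦ hMiI y τ hτ)
    obtain ⟨a, b, hb, hmab⟩ :=
      Nat.exists_eq_pow_mul_and_not_dvd hm.ne' p (Fact.out : p.Prime).ne_one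
    have hmI : ∀ τ ∈ 𝔐.inertia G, Affine.Point.map ((absoluteGaloisGroup.toAlgEquiv (v.adicCompletion K) τ : AlgebraicClosure (v.adicCompletion K) ≃ₐ[v.adicCompletion K] AlgebraicClosure (v.adicCompletion K)) : AlgebraicClosure (v.adicCompletion K) →ₐ[v.adicCompletion K] AlgebraicClosure (v.adicCompletion K)) (m • Φ y) = m • Φ y :=
      fun τ hτ ↦ by rw [map_nsmul, hMiI y τ hτ]
    obtain ⟨u, -, hufix, hu⟩ := W.exists_pow_nsmul_eq_of_mem_kernel hw h𝔐 hp (a + 1) hmK hmI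
    have hu' : Φ.symm u ∈ Mi := by
      rintro ⟨h, hh⟩
      show h • Φ.symm u = Φ.symm u
      apply Φ.injective
      rw [hΦ, AddEquiv.apply_symm_apply]
      refine hufix h ?_
      rw [map_nsmul, ← hΦ]
      exact congrArg (fun z ↦ m • Φ z) (y.2 ⟨h, hh⟩)
    set u' : Mi := ⟨Φ.symm u, hu'⟩ with hu'def
    have hT₀ : b • y - p • u' ∈ B := by
      rw [hB, PrimaryCoinvariants.mem_primaryComponent_iff_exists_nsmul]
      refine ⟨a, ?_⟩
      apply Subtype.ext
      apply Φ.injective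
      simp only [smul_sub, AddSubgroupClass.coe_nsmul, AddSubgroupClass.coe_sub, map_sub, map_nsmul,
        ZeroMemClass.coe_zero, map_zero, hu'def, AddEquiv.apply_symm_apply]
      rw [← mul_smul, ← mul_smul, ← pow_succ, hu, ← hmab, sub_self]
    have hcop : IsCoprime (b : ℤ) (p : ℤ) :=
      Nat.isCoprime_iff_coprime.mpr ((Nat.Prime.coprime_iff_not_dvd Fact.out).mpr hb).symm
    obtain ⟨α, β, hαβ⟩ := hcop
    refine ⟨α • u' + β • y, ?_⟩
    have e : y - p • (α • u' + β • y) = α • (b • y - p • u') := by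
      have h2 : (1 - (α * b + β * p)) • y = 0 := by rw [hαβ, sub_self, zero_smul]
      have h3 : y - p • (α • u' + β • y) - α • (b • y - p • u') = (1 - (α * b + β * p)) • y := by
        module
      rw [← sub_eq_zero, h3, h2]
    rw [e]
    exact B.zsmul_mem hT₀ α
  -- (b♯) the bridge `B_v ≃ B` to X11b's coinvariant count `[B_v : (γ_v - 1)B_v] = p ^ ord_p c_v`
  let fB : B →+ B := (f.comp B.subtype).codRestrict B
    fun b ↦ PrimaryCoinvariants.map_mem_primaryComponent p f b.2
  have hfB : ∀ b, (fB b : Mi) = f b := fun _ ↦ rfl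
  -- X11b's objects: `B_v = E[p^∞]^{ker κ ⊓ D_v}`, `γ_v = res g ∈ D_v`, `γ_v - 1`
  set γ : Field.absoluteGaloisGroup K := resGal (K := K) (v.adicCompletion K) g with hγ
  have hγD : γ ∈ decomp v := hresD g
  let Bv : AddSubgroup (W.geomPrimaryTorsion p) :=
    FixedPoints.addSubgroup ↥(κ.kerSubgroup ⊓ decomp v) (W.geomPrimaryTorsion p)
  let φ : Bv →+ Bv := AcSelmer.decompSubOne κ (W.geomPrimaryTorsion p) γ hγD
  -- the points map `ι₀_* : E(K̄) → E(K̄_v)` restricted to `B_v`, landing in `B`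
  let ι₀ : W.geomPoints →+ Pt := pointsMap W (v.adicCompletion K)
  have hι₀_inj : Function.Injective ι₀ :=
    pointsMapOfEmb_injective W (closureEmb (K := K) (v.adicCompletion K))
  have hι₀_smul : ∀ (σ : G) (P : W.geomPoints),
      ι₀ (resGal (K := K) (v.adicCompletion K) σ • P) = σ • ι₀ P :=
    fun σ P ↦ pointsMap_smul W (v.adicCompletion K) σ P
  have hmemMi : ∀ m : Bv, ι₀ ((m : W.geomPrimaryTorsion p) : W.geomPoints) ∈ Mi := by
    rintro m ⟨h, hh⟩
    have hhker : resGal (K := K) (v.adicCompletion K) h ∈ κ.kerSubgroup :=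
      (mem_localSubgroup_iff _ _ h).mp hh
    have hfix := m.2 ⟨resGal (K := K) (v.adicCompletion K) h, Subgroup.mem_inf.mpr ⟨hhker, hresD h⟩⟩
    have hfix' : resGal (K := K) (v.adicCompletion K) h •
        ((m : W.geomPrimaryTorsion p) : W.geomPoints) = (m : W.geomPrimaryTorsion p) :=
      congrArg (fun x : W.geomPrimaryTorsion p ↦ (x : W.geomPoints)) hfix
    show h • ι₀ ((m : W.geomPrimaryTorsion p) : W.geomPoints) = ι₀ _
    rw [← hι₀_smul, hfix']
  have hmemB : ∀ m : Bv,
      (⟨ι₀ ((m : W.geomPrimaryTorsion p) : W.geomPoints), hmemMi m⟩ : Mi) ∈ B := by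
    intro m
    obtain ⟨k, hk⟩ := (AddCommGroup.mem_primaryComponent (G := W.geomPoints)).mp
      ((m : W.geomPrimaryTorsion p)).2
    rw [hB, PrimaryCoinvariants.mem_primaryComponent_iff_exists_nsmul]
    refine ⟨k, Subtype.ext ?_⟩
    change p ^ k • ι₀ ((m : W.geomPrimaryTorsion p) : W.geomPoints) = 0
    rw [← map_nsmul, hk, map_zero]
  let e₀ : Bv →+ B :=
    { toFun := fun m ↦ ⟨⟨ι₀ ((m : W.geomPrimaryTorsion p) : W.geomPoints), hmemMi m⟩, hmemB m⟩
      map_zero' := by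
        apply Subtype.ext; apply Subtype.ext
        change ι₀ ((0 : W.geomPrimaryTorsion p) : W.geomPoints) = 0
        rw [ZeroMemClass.coe_zero, map_zero]
      map_add' := fun a b ↦ by
        apply Subtype.ext; apply Subtype.ext
        change ι₀ (((a + b : Bv) : W.geomPrimaryTorsion p) : W.geomPoints) = ι₀ _ + ι₀ _
        rw [AddSubgroup.coe_add, AddSubgroup.coe_add, map_add] }
  have he₀ : ∀ m : Bv, (((e₀ m : B) : Mi) : Pt) = ι₀ ((m : W.geomPrimaryTorsion p) : W.geomPoints) :=
    fun _ ↦ rfl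
  have he₀_inj : Function.Injective e₀ := by
    intro a b hab
    have h := congrArg (fun x : B ↦ ((x : Mi) : Pt)) hab
    simp only [he₀] at h
    exact Subtype.ext (Subtype.ext (hι₀_inj h))
  have he₀_surj : Function.Surjective e₀ := by
    intro b
    obtain ⟨k, hk⟩ := (PrimaryCoinvariants.mem_primaryComponent_iff_exists_nsmul p (b : Mi)).mp b.2
    have hkPt : p ^ k • (((b : B) : Mi) : Pt) = 0 := by
      have := congrArg (fun z : Mi ↦ (z : Pt)) hk
      simpa only [AddSubgroupClass.coe_nsmul, ZeroMemClass.coe_zero] using this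
    obtain ⟨P, hPk, hP⟩ := exists_pointsMapOfEmb_eq_of_nsmul_eq_zero W
      (closureEmb (K := K) (v.adicCompletion K)) (pow_ne_zero k (Fact.out : p.Prime).ne_zero) hkPt
    have hPprim : P ∈ W.geomPrimaryTorsion p :=
      (AddCommGroup.mem_primaryComponent (G := W.geomPoints)).mpr ⟨k, hPk⟩
    have hP' : ι₀ P = (((b : B) : Mi) : Pt) := hP
    -- `P` is fixed by `ker κ ⊓ D_v`
    have hPfix : (⟨P, hPprim⟩ : W.geomPrimaryTorsion p) ∈ Bv := by
      rintro ⟨x, hx⟩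
      obtain ⟨hxker, hxD⟩ := Subgroup.mem_inf.mp hx
      obtain ⟨σ, hσ⟩ := (mem_decomp_iff v x).mp hxD
      rw [← resGal_eq_absGaloisRestrict] at hσ
      have hσHi : σ ∈ Hi := (mem_localSubgroup_iff _ _ σ).mpr (hσ ▸ hxker)
      apply Subtype.ext
      change x • P = P
      apply hι₀_inj
      rw [← hσ, hι₀_smul, hP']
      exact ((b : B) : Mi).2 ⟨σ, hσHi⟩
    refine ⟨⟨⟨P, hPprim⟩, hPfix⟩, ?_⟩
    apply Subtype.ext; apply Subtype.ext
    exact hP'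
  let e : Bv ≃+ B := AddEquiv.ofBijective e₀ ⟨he₀_inj, he₀_surj⟩
  -- `e` intertwines `γ_v - 1` and `g - 1`
  have hinter : ∀ m : Bv, e (φ m) = fB (e m) := by
    intro m
    apply Subtype.ext; apply Subtype.ext
    change ι₀ (((φ m : Bv) : W.geomPrimaryTorsion p) : W.geomPoints) = ((f (e₀ m : B) : Mi) : Pt)
    rw [coe_subOne_apply]
    change ι₀ (((AcSelmer.decompSubOne κ (W.geomPrimaryTorsion p) γ hγD m :
        W.geomPrimaryTorsion p)) : W.geomPoints) =
      g • ι₀ ((m : W.geomPrimaryTorsion p) : W.geomPoints) -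
        ι₀ ((m : W.geomPrimaryTorsion p) : W.geomPoints)
    rw [AcSelmer.coe_decompSubOne_apply, AddSubgroup.coe_sub, primaryComponent.coe_smul, map_sub,
      hγ, hι₀_smul]
  have hmap : AddSubgroup.map (e : Bv →+ B) φ.range = fB.range := by
    ext b
    constructor
    · rintro ⟨x, ⟨y, rfl⟩, rfl⟩
      exact ⟨e y, (hinter y).symm⟩
    · rintro ⟨y, rfl⟩
      refine ⟨φ (e.symm y), ⟨e.symm y, rfl⟩, ?_⟩
      change e (φ (e.symm y)) = fB y
      rw [hinter, AddEquiv.apply_symm_apply]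
  let eq : Bv ⧸ φ.range ≃+ B ⧸ fB.range := QuotientAddGroup.congr _ _ e hmap
  -- X11b: `[B_v : (γ_v - 1)B_v] = p ^ ord_p c_v`, for `res g` generating `D_v` modulo `D_v ⊓ ker κ`
  have hgen' := decomp_generate_of_localSubgroup_generate κ hgen hγD
  have hidx := AcSelmer.index_range_decompSubOne_eq_pow W κ hpv hv hgen'
  -- conclude: `#(B/fB(B)) = [B_v : (γ_v - 1)B_v] = p ^ ord_p c_v`
  have hcardQ : Nat.card (B ⧸ fB.range) =
      p ^ padicValNat p ((W.baseChange (v.adicCompletion K)).localTamagawaNumber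
        (v.adicCompletionIntegers K)) := by
    rw [← hidx, AddSubgroup.index_eq_card]
    exact (Nat.card_congr eq.toEquiv).symm
  haveI : Finite (B ⧸ fB.range) := Nat.finite_of_card_ne_zero
    (by rw [hcardQ]; exact pow_ne_zero _ (Fact.out : p.Prime).ne_zero)
  -- (c) the `p`-power torsion of the coinvariants is the image of `B/f(B)`
  have h := PrimaryCoinvariants.finite_primaryComponent_quotient p f fB hfB hdiv
  exact ⟨h.1, h.2.trans hcardQ.le⟩

/-- **The packet for the Tamagawa-tolerant consumer**: at `v ∤ p`, `𝒦_{v,0}[p^∞]` is finite of order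
`≤ p ^ ord_p c_v`, for every `ℤ_p`-extension and every reduction type.
[cite: GreenbergLNM1716, §3 Lemma 3.3 (proof, pp. 86–88) and §4 proof of Thm. 4.1 (p. 74)] -/
theorem finite_and_natCard_localTowerKerPrimary_zero_le_pow_padicValNat_localTamagawaNumber
    [W.IsElliptic] (hpv : (p : 𝓞 K) ∉ v.asIdeal) :
    Finite (W.localTowerKerPrimary κ (v.adicCompletion K) 0) ∧
      Nat.card (W.localTowerKerPrimary κ (v.adicCompletion K) 0) ≤
        p ^ padicValNat p ((W.baseChange (v.adicCompletion K)).localTamagawaNumber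
          (v.adicCompletionIntegers K)) :=
  ⟨W.finite_localTowerKerPrimary_zero_of_not_mem κ hpv,
    natCard_localTowerKerPrimary_zero_le_pow_padicValNat_localTamagawaNumber W κ hpv⟩

end Summit.BirchSwinnertonDyer.Rank1Residual.Iwasawa

end
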